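import Summits.Parity.GeneralizedHardyLittlewood.Theses.ChenParityOracleBLAP
import Summits.Parity.GeneralizedHardyLittlewood.Theorems.ChenParityOracleBLAPHostParityFromBrickPrimeHostFinal
import Summits.Parity.GeneralizedHardyLittlewood.Theorems.ChenParityOracleBLAPHostParityFromBrickBoxes
import HarnessLib

/-!
# Route `ChenParityOracleBLAP` — crux S1 = `HostParityFromBrick` (stmt-Parity-20045): the prime half `K1 → K2 → HP1`

The PRIME half of S1, closed: from the brick — K1 = `BilinearLiouvilleMean` and
K2 = `BilinearLiouvilleAP` (both OPEN; Type-II information for `λ(mn ± 2)` on the window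
`x^{1/3−δ₁} ≤ M ≤ x^{1/2}`, `x^{1−δ₁} ≤ MN ≤ x`, coefficients 1-bounded and supported on
`w₀`-rough integers, `w₀ = exp(log x/log log x)`) — the host-parity level statement HP1 for the
prime host: for every `ε, η > 0`,
`∑_{d ≤ x^{1/2−ε}} |∑_{p ≤ x, d ∣ p+2} λ(p+2)| ≤ η x/(log x)²` for all large `x`
(`hostParity_prime`).  Proof (`…PrimeHostFinal.prime_eventually`): partial summation to `Λ`;
Vaughan's identity on the `w₀`-rough part with `U = x^{1/3−δ/2}` (`…VaughanSplit`); the Type-I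
pieces by the sifted Type-I bound (`…SiftedTypeI`: Siegel–Walfisz for `λ` + BFI Theorem 0a + an
exact Möbius sieve on a sparse set); the Type-II pieces as `(1+(log x)^{-34})`-adic K-classes of
hyperbolic bilinear forms (`…TypeIIHyperbolic`, K1/K2 at `A = 90`); trivial pieces
(`…VaughanSmall`); common `δ = min δ₁ δ₂` (`window_mono`).  Honesty: this is the bookkeeping half
of a CONDITIONAL reduction; K1, K2 remain open.

References: R. C. Vaughan, Acta Arith. 37 (1980) [Vaughan1980]; E. Bombieri, J. Friedlander,
H. Iwaniec, Acta Math. 156 (1986) [BFI1986]; H. Iwaniec, E. Kowalski, *Analytic Number Theory*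
(2004), §13.4, §17.3 [IwaniecKowalski2004].
-/

namespace Summit.Parity.GeneralizedHardyLittlewood.Theorems

open Finset Real
open Summit.Parity.GeneralizedHardyLittlewood.Theses.ChenParityOracleBLAP

/-- **HP1 from the brick (the prime half of S1).**  `K1 → K2 → HP1`: for every `ε, η > 0`,
`∑_{d ≤ x^{1/2−ε}} |∑_{p ≤ x, d ∣ p+2} λ(p+2)| ≤ η x/(log x)²` for all large `x`. -/
theorem hostParity_prime (k₁ : BilinearLiouvilleMean) (k₂ : BilinearLiouvilleAP) :
    ∀ ε : ℝ, 0 < ε → ∀ η : ℝ, 0 < η → ∃ x₀ : ℕ, ∀ x : ℕ, x₀ ≤ x →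
      (∑ d ∈ Finset.Icc 1 ⌊(x : ℝ) ^ (1 / 2 - ε)⌋₊,
        |∑ p ∈ (Nat.primesLE x).filter (fun p => d ∣ p + 2),
          (ArithmeticFunction.liouville (p + 2) : ℝ)|) ≤ η * (x : ℝ) / Real.log x ^ 2 := by
  intro ε hε η hη
  obtain ⟨δ₁, hδ₁0, hδ₁1, h1⟩ := k₁
  obtain ⟨δ₂, hδ₂0, hδ₂1, h2⟩ := k₂
  obtain ⟨x₁, hx₁⟩ := h1 90 (by norm_num)
  obtain ⟨x₂, hx₂⟩ := h2 ε hε 90 (by norm_num)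
  have hδ0 : 0 < min δ₁ δ₂ := lt_min hδ₁0 hδ₂0
  have hδ1 : min δ₁ δ₂ ≤ 1 / 12 := (min_le_left _ _).trans (by linarith)
  refine prime_eventually hδ0 hδ1 hε (x₁ := max 1 x₁) (x₂ := max 1 x₂) ?_ ?_ hη
  · intro x hx
    have hx1 : 1 ≤ x := le_trans (le_max_left _ _) hx
    exact window_mono hx1 (min_le_left δ₁ δ₂) _ (hx₁ x (le_trans (le_max_right _ _) hx))
  · intro x hx
    have hx1 : 1 ≤ x := le_trans (le_max_left _ _) hx
    exact window_mono hx1 (min_le_right δ₁ δ₂) _ (hx₂ x (le_trans (le_max_right _ _) hx))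

end Summit.Parity.GeneralizedHardyLittlewood.Theorems
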